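import Summits.QuantumFields.BalabanUV.Beta.D1BFx.GhostWardWord
import Summits.QuantumFields.BalabanUV.Beta.D1BFx.PackedWordSplit
import Summits.QuantumFields.BalabanUV.Beta.D1BFx.GhostRayScaling
import Summits.QuantumFields.BalabanUV.Beta.D1BFx.TorusGhostPairStencils

/-!
# `BalabanUV.Beta.D1BFx.GhostDeficitFormula` — road «BF-x» for binder row D1, slot (K), junction (J3): **THE REST OF (J3) IS A FIXED KERNEL —
# `RJ3 n = (4·N²·n⁸ − 2)·PghQ n a (−1) n² a + 2·(the four Q′-words at the road's dressed weights)`**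

PART 14 (`RoadEndBFxRoadScalesS`, p331212) ∕ PART 15 display the (J3) junction at each scale `n` as
`hJ3 : −2·hessKer (Ggh n a) (n²•𝒢[colH G₀; ghCur]) (n²•𝒟[colH G₀; gh₂]) μ ν z = ωgh n·PghQ n a (x₀ n) (cK n) (cQ n) μ ν z + RJ3 n μ ν z`
(`G₀ = coDressKBmAt (toSite r) n (KInvStep n 0)`, the road's per-scale dressing root `r ∈ box 4 n`) with the rest `RJ3 n` FREE and its rows displayed.
THIS FILE computes `RJ3 n` from three kernel facts: (i) leaf-04 g21's GHOST WORD SPLIT (`PackedWordSplit.ghost_word_split`, ROUTE M of the owner's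
TB5-1′): the packed word of the COMPLETED ghost data `(SghAt, WghAt)` at any decaying weight family = the word of its `D*D` part + four `Q′`-words;
(ii) leaf-04 g21's GHOST WARD TRANSVERSALITY at the word level (`GhostWardWord.ghost_word_dressed_eq_PghQ`): at the centred stencil root the road's
CO-DRESSED completed word IS the END's `PghQ` on the ray, for every dressing root `r`; (iii) the owner's «J3-SCALING» (`GhostRayScaling.ghost_ray_idle`): on
the END's rows `hs hKray hQray hx hlam hωs` the main term is `−4N²n⁸·PghQ n a (−1) n² a`.  The road-side identification (this file, §1–§2): PART 14's two
ghost jets `n²•𝒢[w; ghCur]`, `n²•𝒟[w; gh₂]` ARE the `D*D` part of leaf-04's packing at the unit ray `(x₀, cK, cQ) = (−1, n², a)` — `gh₂ = −ghX`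
(`TorusGhostPairStencils.gh₂` vs `GhostStencilReflection.ghX`) and the `diagExt` table packs diagonally.  HENCE (§3 **`road_ghost_word_eq`** (no END letter): road word `= −2·PghQ n a (−1) n² a + 2·BR n`; **`J3_closed_form`**; **`RJ3_formula`**; and, for the owner's ρ-g20-2, **`tower_weight_road_ghost_word_eq`** ∕ **`J3_of_tower_weight`**: with `Λ n = ωgl n·cE n²` in front of the road's word the gap term vanishes identically and the rest is `2·Λ n·BR n`): on those rows,
`RJ3 n μ ν z = (4·N²·n⁸ − 2)·PghQ n a (−1) n² a μ ν z + 2·BR n μ ν z`, `BR` = leaf-04's bracket of the four `Q′`-words (`½·tadpole` of the `qSqAt` table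
`− ½·` three `qAntiAt` bubbles) at the weights `colH G₀ n`, stencil root `ctrHalf n`, unit ray.

WHY IT MATTERS (OWNER FINDING F-g20-1, journal [D1P2-G20-INTENT-2]): the END needs of `RJ3` only m-uniformly bounded second moments (`hMR₃ hC₃`); by
`GhostKernelComplete.bondSecondMoment_PghQ_ray_eq_avgM2` the first summand's bond second moment is `(4N² − 2n⁻⁸)·avgM2 n (fineHessGhQ n a (−1) n² a μ ν)`, so
`hC₃` is satisfiable for the road's ghost word AS TYPED only if the ghost's unit-ray block-averaged fine second moment is n-bounded up to the `Q′`-words' —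
the factor `2N²n⁸` between the END's reading-(ii) ghost weight and the road's unit-stencil ghost tower, now a kernel identity.  Deciding WHERE that factor
belongs (the END's tie, the road's GH-DICT step, the colour lift, (J1)'s units) is the row owner's ∕ d1-p3's; this file asserts nothing about it.

HONEST DEPENDENCY (cell records, verbatim): «continuum YM on T⁴ ⇐ BetaPertH ∧ nine spine estimates (0/9 proved); BetaPertH ⇐ (D1) ∧ (D4) ∧
CAP+tail; G-an2-4 gates asym, D1 and NE2/3/4.»  HONEST FRAMING (cell contract, verbatim): «discharging `BetaPertH` makes Bałaban's UV stability
UNCONDITIONAL — a real constructive-QFT result; it is NOT the continuum limit and NOT the Clay problem.»  THIS MODULE DISCHARGES NOTHING of (K),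
of D1 or of the wall: [folklore] packing algebra + composition BY NAME of leaf-04 g21's F6∕F7 and the owner's J3-SCALING; `hJ3` and the END's rows
are HYPOTHESES.  No definition, no `def … : Prop`, nothing cited, 0 sorry.  0 root-level binders of row D1 discharged; (J3) remains DISPLAYED;
(K) NOT closed; NOT D1, NOT `BetaPertH`, NOT continuum, NOT Clay.

ABSOLUTE RULE (cell charter, verbatim): «No internally-minted statement may enter as a cited fact. Every hypothesis is either kernel-proved in this
package or a verbatim quotation of a PUBLISHED theorem with page reference. The manuscript(s) under audit are NOT citable for their own disputed
steps — they are the thing under adjudication; programme-internal (2001/route/tribunal) claims are never citable.»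

Unit `b2b-balaban-beta-d1-p2` (road «BF-x» OWNER), gen 20, 2026-08-22.
-/

noncomputable section

namespace Summit.QuantumFields.BalabanUV.Beta.D1BFx.GhostDeficitFormula

open Finset
open scoped BigOperators
open Literature.MathematicalPhysics.QuantumFieldTheory.Balaban1983to89
open Literature.MathematicalPhysics.QuantumFieldTheory.Balaban1983to89.Beta
open ExpKernelCalculus (Site MKer hessKer tadpole bubble)
open AffineAveraging (box toSite)
open OneStepKernelFamily (KInvStep colH)
open OneStepResolventKernel (wsum)
open Summit.QuantumFields.BalabanUV.Beta.AxialDressingRooted (coDressKBmAt)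
open Summit.QuantumFields.BalabanUV.Beta.D1BFx.GhostLeg (Ggh)
open Summit.QuantumFields.BalabanUV.Beta.D1BFx.GhostStencil (ghCur)
open Summit.QuantumFields.BalabanUV.Beta.D1BFx.GhostStencilReflection (ghX ghX_apply)
open Summit.QuantumFields.BalabanUV.Beta.D1BFx.GhostStencilRooted (SghAt qAntiAt)
open Summit.QuantumFields.BalabanUV.Beta.D1BFx.GhostStencilRootedReflection (ctrHalf ctrHalf_mem)
open Summit.QuantumFields.BalabanUV.Beta.D1BFx.GhostAveragingSquare (WghAt qSqAt)
open Summit.QuantumFields.BalabanUV.Beta.D1BFx.ReducedKernelSandwichBlock (diagExt diagExt_apply)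
open Summit.QuantumFields.BalabanUV.Beta.D1BFx.TorusGhostPairStencils (gh₂ gh₂_apply)
open Summit.QuantumFields.BalabanUV.Beta.D1BFx.TorusJetArrays (ptPair ptPair_apply)
open Summit.QuantumFields.BalabanUV.Beta.D1BFx.GhostKernelComplete (PghQ)
open Summit.QuantumFields.BalabanUV.Beta.D1BFx.PackedColumnEnvelope (abs_colH_G₀_road_le colH_G₀_road_weight_nonneg)
open Summit.QuantumFields.BalabanUV.Beta.D1BFx.GhostWardWord (road_rate_pos ghost_word_dressed_eq_PghQ)
open Summit.QuantumFields.BalabanUV.Beta.D1BFx.PackedWordSplit (ghost_word_split)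
open Summit.QuantumFields.BalabanUV.Beta.D1BFx.GhostRayScaling (wsum_const_smul ghost_ray_idle)

/-! ## §1 Packing algebra: scalars out, the diagonal table packs diagonally, `gh₂ = −ghX` -/

section Packing

variable {G : Type*}

/-- [our object] `gh₂ κ u = −ghX κ u` (both are `∓(E_{u+e_κ,u} + E_{u,u+e_κ})`). -/
theorem gh₂_eq_neg_ghX (κ : Fin 4) (u : Site 4) : gh₂ κ u = -ghX κ u := by
  funext x z a b
  rw [gh₂_apply]
  show _ = -(ghX κ u x z a b)
  rw [ghX_apply]
  ring

/-- [our object] The unit-ray second-order `D*D` table: `((−1)·n²) • ghX κ u = n² • gh₂ κ u`. -/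
theorem neg_smul_ghX_eq (n : ℕ) (κ : Fin 4) (u : Site 4) :
    ((-1) * ((n : ℕ) : ℝ) ^ 2) • ghX κ u = (((n : ℕ) : ℝ) ^ 2) • gh₂ κ u := by
  rw [gh₂_eq_neg_ghX, smul_neg, ← neg_smul, neg_mul, one_mul]

/-- [folklore] Scalars come out of a packed family: `Σ_κ wsum (w κ) (u ↦ c • F κ u) = c • (x z a b ↦ Σ_κ wsum (w κ) (F κ) x z a b)`. -/
theorem sum_wsum_smul (w : Fin 4 → Site 4 → ℝ) (c : ℝ) (F : Fin 4 → Site 4 → MKer 4 G) :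
    (∑ κ : Fin 4, wsum (w κ) (fun u => c • F κ u)) = c • (fun x z a b => ∑ κ : Fin 4, wsum (w κ) (F κ) x z a b) := by
  funext x z a b
  simp only [Finset.sum_apply, Pi.smul_apply, smul_eq_mul, wsum_const_smul]
  rw [Finset.mul_sum]

/-- [folklore] **THE DIAGONAL TABLE PACKS DIAGONALLY** (one bond): `wsum w′ (diagExt T κ u l) = [κ = l]·(w′ u • T κ u)`. -/
theorem wsum_diagExt (w' : Site 4 → ℝ) (T : Fin 4 → Site 4 → MKer 4 G) (κ : Fin 4) (u : Site 4) (l : Fin 4) :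
    wsum w' (diagExt T κ u l) = if κ = l then w' u • T κ u else 0 := by
  by_cases h : κ = l
  · subst h
    rw [if_pos rfl]
    funext x z a b
    simp only [wsum, Pi.smul_apply, smul_eq_mul]
    rw [tsum_eq_single u (fun u' hu' => by rw [diagExt_apply, if_neg (fun hc => hu' hc.2.symm), mul_zero])]
    rw [diagExt_apply, if_pos ⟨rfl, rfl⟩]
  · rw [if_neg h]
    funext x z a b
    simp only [wsum, Pi.zero_apply]
    rw [tsum_congr (fun u' => by rw [diagExt_apply, if_neg (fun hc => h hc.1), mul_zero])]
    exact tsum_zero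

/-- [folklore] `wsum` of the zero family vanishes. -/
theorem wsum_zero_family {D : ℕ} (w : (Fin D → ℤ) → ℝ) : wsum w (fun _ => (0 : MKer D G)) = 0 := by
  funext x z a b
  simp only [wsum, Pi.zero_apply, mul_zero, tsum_zero]

/-- [folklore] **THE DIAGONAL TABLE PACKS DIAGONALLY** (two weights): `Σ_κ Σ_l wsum (w₁ κ) (u ↦ wsum (w₂ l) (diagExt T κ u l)) = Σ_κ wsum (w₁ κ) (u ↦ w₂ κ u • T κ u)`. -/
theorem sum_sum_wsum_diagExt (w₁ w₂ : Fin 4 → Site 4 → ℝ) (T : Fin 4 → Site 4 → MKer 4 G) :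
    (∑ κ : Fin 4, ∑ l : Fin 4, wsum (w₁ κ) (fun u => wsum (w₂ l) (diagExt T κ u l)))
      = ∑ κ : Fin 4, wsum (w₁ κ) (fun u => w₂ κ u • T κ u) := by
  refine Finset.sum_congr rfl fun κ _ => ?_
  have h : ∀ l : Fin 4, wsum (w₁ κ) (fun u => wsum (w₂ l) (diagExt T κ u l))
      = if κ = l then wsum (w₁ κ) (fun u => w₂ κ u • T κ u) else 0 := by
    intro l
    by_cases hl : κ = l
    · subst hl
      rw [if_pos rfl]
      congr 1
      funext u
      rw [wsum_diagExt, if_pos rfl]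
    · rw [if_neg hl]
      have hz : (fun u => wsum (w₂ l) (diagExt T κ u l)) = fun _ => (0 : MKer 4 G) :=
        funext fun u => by rw [wsum_diagExt, if_neg hl]
      rw [hz, wsum_zero_family]
  rw [Finset.sum_congr rfl fun l _ => h l, Finset.sum_ite_eq, if_pos (Finset.mem_univ κ)]

end Packing

/-! ## §2 PART 14's ghost jets ARE the `D*D` part of leaf-04's packing at the unit ray -/

section Road

variable (n : ℕ) (w : Fin 4 → Site 4 → Fin 4 → Site 4 → ℝ)

/-- [folklore] PART 14's first ghost jet IS the `D*D` stencil part of the packing at the unit ray: `n²•𝒢[w; ghCur] = 𝒱[w; n²•ghCur]`. -/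
theorem road_stencil_eq :
    (fun κ' v => (((n : ℕ) : ℝ) ^ 2) • (fun x y a b => ∑ κ : Fin 4, wsum (w κ' v κ) (ghCur κ) x y a b))
      = fun μ y => ∑ κ : Fin 4, wsum (w μ y κ) (fun u => (((n : ℕ) : ℝ) ^ 2) • ghCur κ u) := by
  funext μ y
  rw [sum_wsum_smul]

/-- [folklore] PART 14's second ghost jet IS the `D*D` table part of the packing at the unit ray: `n²•𝒟[w; gh₂] = 𝒲[w; diagExt (((−1)·n²)•ghX)]`. -/
theorem road_table_eq :
    (fun κ' v l v' => (((n : ℕ) : ℝ) ^ 2) • (fun x y a b => ∑ κ : Fin 4,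
        wsum (w κ' v κ) (fun u => fun x y a b => w l v' κ u * gh₂ κ u x y a b) x y a b))
      = fun μ y ν y' => ∑ κ : Fin 4, ∑ l : Fin 4, wsum (w μ y κ)
          (fun u => wsum (w ν y' l) (diagExt (fun μ' y'' => ((-1) * ((n : ℕ) : ℝ) ^ 2) • ghX μ' y'') κ u l)) := by
  funext μ y ν y'
  rw [sum_sum_wsum_diagExt]
  have h : ∀ κ : Fin 4, (fun u => w ν y' κ u • (fun μ' y'' => ((-1) * ((n : ℕ) : ℝ) ^ 2) • ghX μ' y'') κ u)
      = fun u => (((n : ℕ) : ℝ) ^ 2) • (fun x y a b => w ν y' κ u * gh₂ κ u x y a b) := by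
    intro κ
    funext u
    show w ν y' κ u • (((-1) * ((n : ℕ) : ℝ) ^ 2) • ghX κ u) = _
    rw [neg_smul_ghX_eq]
    funext x z a b
    simp only [Pi.smul_apply, smul_eq_mul]
    ring
  simp only [h]
  exact (sum_wsum_smul (fun κ => w μ y κ) (((n : ℕ) : ℝ) ^ 2) (fun κ u => fun x y a b => w ν y' κ u * gh₂ κ u x y a b)).symm

end Road

/-! ## §3 The road's ghost word in closed form; (J3) in closed form; the rest of (J3) as a fixed kernel -/

section Formula

variable {N a : ℝ} {cE cK cQ x₀ ωgl ωgh cgh s : ℕ → ℝ} (n : ℕ) [NeZero n] {r : Fin (3 + 1) → ℕ}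

/-- [folklore] **THE ROAD's GHOST WORD IN CLOSED FORM** (no END letter): at every scale `n`, dressing root `r ∈ box 4 n`, `0 < a`, PART 14's ghost main word
EQUALS `−2·PghQ n a (−1) n² a + 2·BR n` — leaf-04's split at the road's dressed weights (stencil root `ctrHalf n`, unit ray) + word-level transversality
(`ghost_word_dressed_eq_PghQ` at `c = 1`) + §2. -/
theorem road_ghost_word_eq (hr : r ∈ box (3 + 1) n) (ha : 0 < a) (μ ν : Fin 4) (z : Site 4) :
    -(2 * hessKer (Ggh n a)
          (fun κ' v => (((n : ℕ) : ℝ) ^ 2) • (fun x y a b => ∑ κ : Fin 4,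
            wsum (colH (coDressKBmAt (toSite r) n (KInvStep (d := 3) n 0)) n κ' v κ) (ghCur κ) x y a b))
          (fun κ' v l v' => (((n : ℕ) : ℝ) ^ 2) • (fun x y a b => ∑ κ : Fin 4,
            wsum (colH (coDressKBmAt (toSite r) n (KInvStep (d := 3) n 0)) n κ' v κ)
              (fun u => fun x y a b => colH (coDressKBmAt (toSite r) n (KInvStep (d := 3) n 0)) n l v' κ u * gh₂ κ u x y a b) x y a b)) μ ν z)
      = -2 * PghQ n a (-1) ((n : ℝ) ^ 2) a μ ν z
        + 2 * ((1 / 2) * tadpole (Ggh n a) (∑ κ : Fin 4, ∑ l : Fin 4, wsum (colH (coDressKBmAt (toSite r) n (KInvStep (d := 3) n 0)) n μ 0 κ)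
              (fun u => wsum (colH (coDressKBmAt (toSite r) n (KInvStep (d := 3) n 0)) n ν z l)
                (fun v' => (-((-1) * a * (n : ℝ) ^ 4)) • qSqAt (ctrHalf n) n κ u l v')))
          - (1 / 2) * (bubble (Ggh n a)
                (∑ κ : Fin 4, wsum (colH (coDressKBmAt (toSite r) n (KInvStep (d := 3) n 0)) n μ 0 κ) (fun u => (((n : ℕ) : ℝ) ^ 2) • ghCur κ u))
                (∑ κ : Fin 4, wsum (colH (coDressKBmAt (toSite r) n (KInvStep (d := 3) n 0)) n ν z κ) (fun u => a • qAntiAt (ctrHalf n) n κ u))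
              + bubble (Ggh n a)
                (∑ κ : Fin 4, wsum (colH (coDressKBmAt (toSite r) n (KInvStep (d := 3) n 0)) n μ 0 κ) (fun u => a • qAntiAt (ctrHalf n) n κ u))
                (∑ κ : Fin 4, wsum (colH (coDressKBmAt (toSite r) n (KInvStep (d := 3) n 0)) n ν z κ) (fun u => (((n : ℕ) : ℝ) ^ 2) • ghCur κ u))
              + bubble (Ggh n a)
                (∑ κ : Fin 4, wsum (colH (coDressKBmAt (toSite r) n (KInvStep (d := 3) n 0)) n μ 0 κ) (fun u => a • qAntiAt (ctrHalf n) n κ u))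
                (∑ κ : Fin 4, wsum (colH (coDressKBmAt (toSite r) n (KInvStep (d := 3) n 0)) n ν z κ) (fun u => a • qAntiAt (ctrHalf n) n κ u)))) := by
  -- the scale as a successor, for leaf-04's `m + 1` currency
  obtain ⟨m, rfl⟩ : ∃ m, n = m + 1 := ⟨n - 1, (Nat.succ_pred_eq_of_ne_zero (NeZero.ne n)).symm⟩
  -- (§2) the road's jets are the `D*D` part of the packing at the unit ray
  rw [road_stencil_eq, road_table_eq]
  -- (i) leaf-04's ghost word split at the road's dressed weights, stencil root `ctrHalf`, unit ray
  have hsplit := ghost_word_split (m + 1) ha (ctrHalf_mem (m + 1)) (-1) (((m + 1 : ℕ) : ℝ) ^ 2) a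
    (w := fun μ y κ => colH (coDressKBmAt (toSite r) (m + 1) (KInvStep (d := 3) (m + 1) 0)) (m + 1) μ y κ)
    (fun μ y κ u => abs_colH_G₀_road_le m hr μ y κ u) (colH_G₀_road_weight_nonneg m) (road_rate_pos m) μ ν z
  -- (ii) leaf-04's word-level transversality: the co-dressed completed word IS `PghQ` on the unit ray
  have hW := congrFun (congrFun (congrFun (ghost_word_dressed_eq_PghQ m hr ha 1) μ) ν) z
  simp only [one_mul] at hW
  rw [hW] at hsplit
  linarith [hsplit]

/-- [folklore] **(J3) IN CLOSED FORM**: on the END's rows `hs hωs hlam hKray hQray hx` (PART 14's types verbatim), at a scale `n ≥ 2`, PART 14's (J3) line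
HOLDS with the EXPLICIT rest `(4·N²·n⁸ − 2)·PghQ n a (−1) n² a + 2·BR n` — the END's expected main term (`−4N²n⁸·PghQ(unit)`, J3-SCALING) minus the road's
(`−2·PghQ(unit)`), plus twice the four `Q′`-words.  This is the `hJ3` PART 16 feeds, with NO free rest. -/
theorem J3_closed_form (hn : 2 ≤ n) (hr : r ∈ box (3 + 1) n) (ha : 0 < a)
    (hs : ∀ n : ℕ, 2 ≤ n → s n = ((n : ℝ) ^ 2)⁻¹) (hωs : ∀ n : ℕ, 2 ≤ n → ωgh n * (s n * cK n) ^ 2 = -2 * (ωgl n * cE n ^ 2))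
    (hlam : ∀ n : ℕ, 2 ≤ n → ωgl n * cE n ^ 2 = 2 * N ^ 2 * (n : ℝ) ^ 8)
    (hKray : ∀ n : ℕ, cK n = cgh n * (n : ℝ) ^ 2) (hQray : ∀ n : ℕ, cQ n = cgh n * a) (hx : ∀ n : ℕ, x₀ n = -cgh n)
    (μ ν : Fin 4) (z : Site 4) :
    -(2 * hessKer (Ggh n a)
          (fun κ' v => (((n : ℕ) : ℝ) ^ 2) • (fun x y a b => ∑ κ : Fin 4,
            wsum (colH (coDressKBmAt (toSite r) n (KInvStep (d := 3) n 0)) n κ' v κ) (ghCur κ) x y a b))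
          (fun κ' v l v' => (((n : ℕ) : ℝ) ^ 2) • (fun x y a b => ∑ κ : Fin 4,
            wsum (colH (coDressKBmAt (toSite r) n (KInvStep (d := 3) n 0)) n κ' v κ)
              (fun u => fun x y a b => colH (coDressKBmAt (toSite r) n (KInvStep (d := 3) n 0)) n l v' κ u * gh₂ κ u x y a b) x y a b)) μ ν z)
      = ωgh n * PghQ n a (x₀ n) (cK n) (cQ n) μ ν z
        + ((4 * N ^ 2 * (n : ℝ) ^ 8 - 2) * PghQ n a (-1) ((n : ℝ) ^ 2) a μ ν z
          + 2 * ((1 / 2) * tadpole (Ggh n a) (∑ κ : Fin 4, ∑ l : Fin 4, wsum (colH (coDressKBmAt (toSite r) n (KInvStep (d := 3) n 0)) n μ 0 κ)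
              (fun u => wsum (colH (coDressKBmAt (toSite r) n (KInvStep (d := 3) n 0)) n ν z l)
                (fun v' => (-((-1) * a * (n : ℝ) ^ 4)) • qSqAt (ctrHalf n) n κ u l v')))
          - (1 / 2) * (bubble (Ggh n a)
                (∑ κ : Fin 4, wsum (colH (coDressKBmAt (toSite r) n (KInvStep (d := 3) n 0)) n μ 0 κ) (fun u => (((n : ℕ) : ℝ) ^ 2) • ghCur κ u))
                (∑ κ : Fin 4, wsum (colH (coDressKBmAt (toSite r) n (KInvStep (d := 3) n 0)) n ν z κ) (fun u => a • qAntiAt (ctrHalf n) n κ u))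
              + bubble (Ggh n a)
                (∑ κ : Fin 4, wsum (colH (coDressKBmAt (toSite r) n (KInvStep (d := 3) n 0)) n μ 0 κ) (fun u => a • qAntiAt (ctrHalf n) n κ u))
                (∑ κ : Fin 4, wsum (colH (coDressKBmAt (toSite r) n (KInvStep (d := 3) n 0)) n ν z κ) (fun u => (((n : ℕ) : ℝ) ^ 2) • ghCur κ u))
              + bubble (Ggh n a)
                (∑ κ : Fin 4, wsum (colH (coDressKBmAt (toSite r) n (KInvStep (d := 3) n 0)) n μ 0 κ) (fun u => a • qAntiAt (ctrHalf n) n κ u))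
                (∑ κ : Fin 4, wsum (colH (coDressKBmAt (toSite r) n (KInvStep (d := 3) n 0)) n ν z κ) (fun u => a • qAntiAt (ctrHalf n) n κ u))))) := by
  rw [ghost_ray_idle (N := N) (a := a) (cE := cE) (ωgl := ωgl) (s := s) n hn hs hωs hlam hKray hQray hx μ ν z,
    road_ghost_word_eq n hr ha μ ν z]
  ring

/-- [folklore] **`RJ3 n = (4·N²·n⁸ − 2)·PghQ n a (−1) n² a + 2·BR n`** — conversely, if PART 14's (J3) line holds at the scale `n ≥ 2` with SOME rest `RJ3v`,
that rest IS the fixed kernel of `J3_closed_form`. -/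
theorem RJ3_formula (hn : 2 ≤ n) (hr : r ∈ box (3 + 1) n) (ha : 0 < a)
    (hs : ∀ n : ℕ, 2 ≤ n → s n = ((n : ℝ) ^ 2)⁻¹) (hωs : ∀ n : ℕ, 2 ≤ n → ωgh n * (s n * cK n) ^ 2 = -2 * (ωgl n * cE n ^ 2))
    (hlam : ∀ n : ℕ, 2 ≤ n → ωgl n * cE n ^ 2 = 2 * N ^ 2 * (n : ℝ) ^ 8)
    (hKray : ∀ n : ℕ, cK n = cgh n * (n : ℝ) ^ 2) (hQray : ∀ n : ℕ, cQ n = cgh n * a) (hx : ∀ n : ℕ, x₀ n = -cgh n)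
    (RJ3v : Fin 4 → Fin 4 → Site 4 → ℝ) (μ ν : Fin 4) (z : Site 4)
    (hJ3 : -(2 * hessKer (Ggh n a)
          (fun κ' v => (((n : ℕ) : ℝ) ^ 2) • (fun x y a b => ∑ κ : Fin 4,
            wsum (colH (coDressKBmAt (toSite r) n (KInvStep (d := 3) n 0)) n κ' v κ) (ghCur κ) x y a b))
          (fun κ' v l v' => (((n : ℕ) : ℝ) ^ 2) • (fun x y a b => ∑ κ : Fin 4,
            wsum (colH (coDressKBmAt (toSite r) n (KInvStep (d := 3) n 0)) n κ' v κ)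
              (fun u => fun x y a b => colH (coDressKBmAt (toSite r) n (KInvStep (d := 3) n 0)) n l v' κ u * gh₂ κ u x y a b) x y a b)) μ ν z)
      = ωgh n * PghQ n a (x₀ n) (cK n) (cQ n) μ ν z + RJ3v μ ν z) :
    RJ3v μ ν z = (4 * N ^ 2 * (n : ℝ) ^ 8 - 2) * PghQ n a (-1) ((n : ℝ) ^ 2) a μ ν z
      + 2 * ((1 / 2) * tadpole (Ggh n a) (∑ κ : Fin 4, ∑ l : Fin 4, wsum (colH (coDressKBmAt (toSite r) n (KInvStep (d := 3) n 0)) n μ 0 κ)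
              (fun u => wsum (colH (coDressKBmAt (toSite r) n (KInvStep (d := 3) n 0)) n ν z l)
                (fun v' => (-((-1) * a * (n : ℝ) ^ 4)) • qSqAt (ctrHalf n) n κ u l v')))
          - (1 / 2) * (bubble (Ggh n a)
                (∑ κ : Fin 4, wsum (colH (coDressKBmAt (toSite r) n (KInvStep (d := 3) n 0)) n μ 0 κ) (fun u => (((n : ℕ) : ℝ) ^ 2) • ghCur κ u))
                (∑ κ : Fin 4, wsum (colH (coDressKBmAt (toSite r) n (KInvStep (d := 3) n 0)) n ν z κ) (fun u => a • qAntiAt (ctrHalf n) n κ u))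
              + bubble (Ggh n a)
                (∑ κ : Fin 4, wsum (colH (coDressKBmAt (toSite r) n (KInvStep (d := 3) n 0)) n μ 0 κ) (fun u => a • qAntiAt (ctrHalf n) n κ u))
                (∑ κ : Fin 4, wsum (colH (coDressKBmAt (toSite r) n (KInvStep (d := 3) n 0)) n ν z κ) (fun u => (((n : ℕ) : ℝ) ^ 2) • ghCur κ u))
              + bubble (Ggh n a)
                (∑ κ : Fin 4, wsum (colH (coDressKBmAt (toSite r) n (KInvStep (d := 3) n 0)) n μ 0 κ) (fun u => a • qAntiAt (ctrHalf n) n κ u))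
                (∑ κ : Fin 4, wsum (colH (coDressKBmAt (toSite r) n (KInvStep (d := 3) n 0)) n ν z κ) (fun u => a • qAntiAt (ctrHalf n) n κ u)))) := by
  have h := J3_closed_form (N := N) (cE := cE) (ωgl := ωgl) (ωgh := ωgh) (cgh := cgh) (s := s) n hn hr ha hs hωs hlam hKray hQray hx μ ν z
  linarith [h, hJ3]

/-- [folklore] **THE TOWER WEIGHT CLOSES THE GAP** (owner's ρ-g20-2, the algebra only): with the END's gluon normalisation `Λ n := ωgl n·cE n²` in front of
the road's ghost word, `hlam` ALONE gives `Λ n·(road ghost word) = −(4·N²·n⁸)·PghQ n a (−1) n² a + 2·Λ n·BR n` — the coefficient of `PghQ(unit ray)` is then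
EXACTLY the END's (`GhostRayScaling.ghost_ray_idle`), i.e. no gap term: `4N²n⁸ − 2Λ n = 0`. -/
theorem tower_weight_road_ghost_word_eq (hn : 2 ≤ n) (hr : r ∈ box (3 + 1) n) (ha : 0 < a)
    (hlam : ∀ n : ℕ, 2 ≤ n → ωgl n * cE n ^ 2 = 2 * N ^ 2 * (n : ℝ) ^ 8) (μ ν : Fin 4) (z : Site 4) :
    (ωgl n * cE n ^ 2) * (-(2 * hessKer (Ggh n a)
          (fun κ' v => (((n : ℕ) : ℝ) ^ 2) • (fun x y a b => ∑ κ : Fin 4,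
            wsum (colH (coDressKBmAt (toSite r) n (KInvStep (d := 3) n 0)) n κ' v κ) (ghCur κ) x y a b))
          (fun κ' v l v' => (((n : ℕ) : ℝ) ^ 2) • (fun x y a b => ∑ κ : Fin 4,
            wsum (colH (coDressKBmAt (toSite r) n (KInvStep (d := 3) n 0)) n κ' v κ)
              (fun u => fun x y a b => colH (coDressKBmAt (toSite r) n (KInvStep (d := 3) n 0)) n l v' κ u * gh₂ κ u x y a b) x y a b)) μ ν z))
      = -(4 * N ^ 2 * (n : ℝ) ^ 8) * PghQ n a (-1) ((n : ℝ) ^ 2) a μ ν z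
        + 2 * (ωgl n * cE n ^ 2) * ((1 / 2) * tadpole (Ggh n a) (∑ κ : Fin 4, ∑ l : Fin 4, wsum (colH (coDressKBmAt (toSite r) n (KInvStep (d := 3) n 0)) n μ 0 κ)
              (fun u => wsum (colH (coDressKBmAt (toSite r) n (KInvStep (d := 3) n 0)) n ν z l)
                (fun v' => (-((-1) * a * (n : ℝ) ^ 4)) • qSqAt (ctrHalf n) n κ u l v')))
          - (1 / 2) * (bubble (Ggh n a)
                (∑ κ : Fin 4, wsum (colH (coDressKBmAt (toSite r) n (KInvStep (d := 3) n 0)) n μ 0 κ) (fun u => (((n : ℕ) : ℝ) ^ 2) • ghCur κ u))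
                (∑ κ : Fin 4, wsum (colH (coDressKBmAt (toSite r) n (KInvStep (d := 3) n 0)) n ν z κ) (fun u => a • qAntiAt (ctrHalf n) n κ u))
              + bubble (Ggh n a)
                (∑ κ : Fin 4, wsum (colH (coDressKBmAt (toSite r) n (KInvStep (d := 3) n 0)) n μ 0 κ) (fun u => a • qAntiAt (ctrHalf n) n κ u))
                (∑ κ : Fin 4, wsum (colH (coDressKBmAt (toSite r) n (KInvStep (d := 3) n 0)) n ν z κ) (fun u => (((n : ℕ) : ℝ) ^ 2) • ghCur κ u))
              + bubble (Ggh n a)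
                (∑ κ : Fin 4, wsum (colH (coDressKBmAt (toSite r) n (KInvStep (d := 3) n 0)) n μ 0 κ) (fun u => a • qAntiAt (ctrHalf n) n κ u))
                (∑ κ : Fin 4, wsum (colH (coDressKBmAt (toSite r) n (KInvStep (d := 3) n 0)) n ν z κ) (fun u => a • qAntiAt (ctrHalf n) n κ u)))) := by
  rw [road_ghost_word_eq n hr ha μ ν z, hlam n hn]
  ring

/-- [folklore] **(J3) UNDER THE TOWER WEIGHT — NO GAP ROW** (ρ-g20-2): on the END's rows, `Λ n·(road ghost word) = ωgh n·PghQ n a (x₀ n) (cK n) (cQ n) + 2·Λ n·BR n`,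
`Λ n = ωgl n·cE n²` — the (J3) line of a road whose (J1) carries the tower weight holds with the rest `2·Λ n·BR n` ONLY (the four `Q′`-words, weighted). -/
theorem J3_of_tower_weight (hn : 2 ≤ n) (hr : r ∈ box (3 + 1) n) (ha : 0 < a)
    (hs : ∀ n : ℕ, 2 ≤ n → s n = ((n : ℝ) ^ 2)⁻¹) (hωs : ∀ n : ℕ, 2 ≤ n → ωgh n * (s n * cK n) ^ 2 = -2 * (ωgl n * cE n ^ 2))
    (hlam : ∀ n : ℕ, 2 ≤ n → ωgl n * cE n ^ 2 = 2 * N ^ 2 * (n : ℝ) ^ 8)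
    (hKray : ∀ n : ℕ, cK n = cgh n * (n : ℝ) ^ 2) (hQray : ∀ n : ℕ, cQ n = cgh n * a) (hx : ∀ n : ℕ, x₀ n = -cgh n)
    (μ ν : Fin 4) (z : Site 4) :
    (ωgl n * cE n ^ 2) * (-(2 * hessKer (Ggh n a)
          (fun κ' v => (((n : ℕ) : ℝ) ^ 2) • (fun x y a b => ∑ κ : Fin 4,
            wsum (colH (coDressKBmAt (toSite r) n (KInvStep (d := 3) n 0)) n κ' v κ) (ghCur κ) x y a b))
          (fun κ' v l v' => (((n : ℕ) : ℝ) ^ 2) • (fun x y a b => ∑ κ : Fin 4,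
            wsum (colH (coDressKBmAt (toSite r) n (KInvStep (d := 3) n 0)) n κ' v κ)
              (fun u => fun x y a b => colH (coDressKBmAt (toSite r) n (KInvStep (d := 3) n 0)) n l v' κ u * gh₂ κ u x y a b) x y a b)) μ ν z))
      = ωgh n * PghQ n a (x₀ n) (cK n) (cQ n) μ ν z
        + 2 * (ωgl n * cE n ^ 2) * ((1 / 2) * tadpole (Ggh n a) (∑ κ : Fin 4, ∑ l : Fin 4, wsum (colH (coDressKBmAt (toSite r) n (KInvStep (d := 3) n 0)) n μ 0 κ)
              (fun u => wsum (colH (coDressKBmAt (toSite r) n (KInvStep (d := 3) n 0)) n ν z l)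
                (fun v' => (-((-1) * a * (n : ℝ) ^ 4)) • qSqAt (ctrHalf n) n κ u l v')))
          - (1 / 2) * (bubble (Ggh n a)
                (∑ κ : Fin 4, wsum (colH (coDressKBmAt (toSite r) n (KInvStep (d := 3) n 0)) n μ 0 κ) (fun u => (((n : ℕ) : ℝ) ^ 2) • ghCur κ u))
                (∑ κ : Fin 4, wsum (colH (coDressKBmAt (toSite r) n (KInvStep (d := 3) n 0)) n ν z κ) (fun u => a • qAntiAt (ctrHalf n) n κ u))
              + bubble (Ggh n a)
                (∑ κ : Fin 4, wsum (colH (coDressKBmAt (toSite r) n (KInvStep (d := 3) n 0)) n μ 0 κ) (fun u => a • qAntiAt (ctrHalf n) n κ u))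
                (∑ κ : Fin 4, wsum (colH (coDressKBmAt (toSite r) n (KInvStep (d := 3) n 0)) n ν z κ) (fun u => (((n : ℕ) : ℝ) ^ 2) • ghCur κ u))
              + bubble (Ggh n a)
                (∑ κ : Fin 4, wsum (colH (coDressKBmAt (toSite r) n (KInvStep (d := 3) n 0)) n μ 0 κ) (fun u => a • qAntiAt (ctrHalf n) n κ u))
                (∑ κ : Fin 4, wsum (colH (coDressKBmAt (toSite r) n (KInvStep (d := 3) n 0)) n ν z κ) (fun u => a • qAntiAt (ctrHalf n) n κ u)))) := by
  rw [tower_weight_road_ghost_word_eq (N := N) (cE := cE) (ωgl := ωgl) n hn hr ha hlam μ ν z,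
    ghost_ray_idle (N := N) (a := a) (cE := cE) (ωgl := ωgl) (s := s) n hn hs hωs hlam hKray hQray hx μ ν z]

end Formula

end Summit.QuantumFields.BalabanUV.Beta.D1BFx.GhostDeficitFormula

end
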